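import Summits.Ventures.PercRepro.ThetaOmegaGraphOddCycle

/-!
# The graph form of (Ω): strictness from the two halves of the dichotomy

Addendum 85 supplement 3 (mine-1, gen 46). The census says that (Ω_Γ) is STRICT from five members
on: every hitting family has at least `|F| + 1` members. In the bipartite / odd-cycle dichotomy
this splits into two conjectures, each a statement about one kind of free graph:

* `OmegaBipartiteStrict α` — **(Ω⁺)**: for `|F| ≥ 5`, a hitting family with a BIPARTITE free
  graph has at least `|F| + 1` members (the strict form of the theorem (Ω));
* `OmegaOddCycle α` — **T⁺** (`ThetaOmegaGraphOddCycle.lean`): for `|F| ≥ 4`, a hitting family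
  with a non-bipartite free graph has at least `|F| + 1` members;
* `OmegaHittingStrict α` — **the strict triangle form**: for `|F| ≥ 5` every hitting family has
  at least `|F| + 1` members;
* `omegaHittingStrict_of_bipartiteStrict_of_oddCycle` — **(Ω⁺) ∧ T⁺ ⟹ strictness**;
  `card_le_of_hittingStrict` — strictness one size down gives the bound at the next size
  (delete a member: the hitting family still hits the smaller family) — the kernel twin of the
  deletion step `card_le_omegaCountG_of_erase` in the triangle language.
-/

namespace PercRepro.MSTight

open Finset

variable {α : Type*} [DecidableEq α]

/-- **(Ω⁺), the strict form of (Ω)**: for a family of at least five members, a hitting family with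
a bipartite free graph has at least `|F| + 1` members. -/
def OmegaBipartiteStrict (α : Type*) [DecidableEq α] : Prop :=
  ∀ (U : Finset α) (F : Finset (Finset α)) (M : Finset (Finset α × Bool)),
    (∀ s ∈ F, s ⊆ U) → 5 ≤ F.card → HitsTriples U F M → BipartiteFree U F M →
      F.card + 1 ≤ M.card

/-- **The strict triangle form**: for a family of at least five members every hitting family has
at least `|F| + 1` members. -/
def OmegaHittingStrict (α : Type*) [DecidableEq α] : Prop :=
  ∀ (U : Finset α) (F : Finset (Finset α)) (M : Finset (Finset α × Bool)),
    (∀ s ∈ F, s ⊆ U) → 5 ≤ F.card → HitsTriples U F M → F.card + 1 ≤ M.card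

/-- **(Ω⁺) and T⁺ together give strictness**: a hitting family has a bipartite free graph or not. -/
theorem omegaHittingStrict_of_bipartiteStrict_of_oddCycle (hB : OmegaBipartiteStrict α)
    (hT : OmegaOddCycle α) : OmegaHittingStrict α := by
  intro U F M hF h5 hM
  by_cases hb : BipartiteFree U F M
  · exact hB U F M hF h5 hM hb
  · exact hT U F M hF (by omega) hM hb

/-- Hitting the triples of `F` hits the triples of `F.erase s`. -/
theorem hitsTriples_erase {U : Finset α} {F : Finset (Finset α)} {M : Finset (Finset α × Bool)}
    (hM : HitsTriples U F M) (s : Finset α) : HitsTriples U (F.erase s) M :=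
  fun u v w hu hv hw => hM u v w (mem_of_mem_erase hu) (mem_of_mem_erase hv) (mem_of_mem_erase hw)

/-- **Strictness one size down gives the bound**: for `|F| ≥ 6`, a hitting family of `F` hits the
triples of `F.erase s`, a family of `|F| - 1 ≥ 5` members, hence has at least `|F|` members. -/
theorem card_le_of_hittingStrict (hS : OmegaHittingStrict α) {U : Finset α}
    {F : Finset (Finset α)} {M : Finset (Finset α × Bool)} (hF : ∀ s ∈ F, s ⊆ U)
    (h6 : 6 ≤ F.card) (hM : HitsTriples U F M) : F.card ≤ M.card := by
  obtain ⟨s, hs⟩ : F.Nonempty := card_pos.1 (by omega)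
  have h := hS U (F.erase s) M (fun t ht => hF t (mem_of_mem_erase ht))
    (by rw [card_erase_of_mem hs]; omega) (hitsTriples_erase hM s)
  rw [card_erase_of_mem hs] at h
  omega

end PercRepro.MSTight
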